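import Summits.KontsevichZagierPeriods.KontsevichZagierPeriods.Theorems.SoloInformedScissorsCongruence
import HarnessLib
import HarnessLib.Audit

/-!
# SoloInformed — the scissors group `𝒮` is an ideal for products with volume representations (COROLLARY NF.2, file A′)

Solo programme `solo-KontsevichZagierPeriods-informed`, session s247 (K-NF.2, companion of
`SoloInformedScissorsCongruence`).

For the scissors group of relations `𝒮 = soloInformedScissorsRel` (generated by the scissors moves and
the volume-preserving `ℚ`-semialgebraic maps between volume representations) this file proves the
structural facts used by the stable statements:

* `soloInformed_of_mul_mem_scissorsRel`, `soloInformed_mul_of_mem_scissorsRel` — `𝒮` is stable under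
  `[τ] * ·` and `· * [τ]` for every volume representation `τ` (the block maps `id × Φ` of
  `SoloInformedEquidimStability` are volume-preserving maps, `τ × (σ₁ ∪ σ₂) = τ × σ₁ ∪ τ × σ₂` is a
  scissors move, and the block flip `σ × τ ↔ τ × σ` is a coordinate permutation, `|det| = 1`:
  `soloInformed_of_prod_sub_of_prod_comm_mem_mapGen`);
* `soloInformed_flatMap_mem_scissorsRel`, `soloInformed_flatPow_mem_scissorsRel` — in particular `𝒮` is
  stable under the flattening operator `Fl = · * [[0,1]]`, so stable scissors congruence of two volume
  representations persists under further flattening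
  (`soloInformed_flatIter_sub_mem_scissorsRel_of_le`);
* `soloInformed_dimProj_mem_scissorsRel` — `𝒮` is homogeneous for the dimension grading (every
  generator lives in one dimension), so congruence of two volume representations of dimension `d`
  modulo `𝒮` only involves volume representations of dimension `d`.

References: M. Kontsevich, D. Zagier, *Periods* (2001), §1.2 rules (1), (2), §4.1;
J. Cresson, J. Viu-Sos, JTNB 34 (2022) 323–343, §3; this work, `paper/nl-elimination.md`
COROLLARY NF.2.
-/

noncomputable section

open scoped BigOperators

namespace Summit.KontsevichZagierPeriods.KontsevichZagierPeriods.Theorems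

open Set MeasureTheory
open Literature.ModelTheory.ExponentialFields
open Literature.NumberTheory.Transcendental Literature.NumberTheory.Transcendental.KZ

variable {n m l k d : ℕ}

/-! ### `𝒮` is an ideal for products with volume representations -/

/-- **Left products**: `c ∈ 𝒮 → [τ] * c ∈ 𝒮` for a volume representation `τ` (the block maps
`id × Φ` of `SoloInformedEquidimStability` are volume-preserving, `τ × (σ₁ ∪ σ₂)` is a scissors
move). [Kontsevich–Zagier 2001, §4.1; this work] -/
theorem soloInformed_of_mul_mem_scissorsRel {t : IntegralRep l} (ht : SoloInformedIsVolRep t)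
    {c : FormalRep} (hc : c ∈ soloInformedScissorsRel) : of t * c ∈ soloInformedScissorsRel := by
  refine AddSubgroup.closure_induction (fun x hx => ?_) ?_ (fun x y _ _ hx hy => ?_)
    (fun x _ hx => ?_) hc
  · rcases hx with hx | hx
    · obtain ⟨n, r, r₁, r₂, hr, h₁, h₂, h, rfl⟩ := hx
      have h' := soloInformed_of_mul_mem_domainAddRel t h
      rw [mul_sub, mul_sub, of_mul_of, of_mul_of, of_mul_of] at h' ⊢
      exact soloInformed_scissorsGen_subset_scissorsRel ⟨l + n, _, _, _,
        soloInformed_isVolRep_prod ht hr, soloInformed_isVolRep_prod ht h₁,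
        soloInformed_isVolRep_prod ht h₂, h', rfl⟩
    · obtain ⟨n, m, r, r', hnm, hr, hr', h, rfl⟩ := hx
      have h' := soloInformed_of_mul_mem_changeOfVariablesRel t h
      rw [mul_sub, of_mul_of, of_mul_of] at h' ⊢
      exact soloInformed_mapGen_subset_scissorsRel ⟨l + n, l + m, _, _, by rw [hnm],
        soloInformed_isVolRep_prod ht hr, soloInformed_isVolRep_prod ht hr', h', rfl⟩
  · rw [mul_zero]; exact soloInformedScissorsRel.zero_mem
  · rw [mul_add]; exact soloInformedScissorsRel.add_mem hx hy
  · rw [mul_neg]; exact soloInformedScissorsRel.neg_mem hx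

/-- **The block flip is a volume-preserving map**: `[τ × σ] − [σ × τ] ∈ soloInformedMapGen` for
volume representations `σ`, `τ` (a coordinate permutation, `|det| = 1`).
[Kontsevich–Zagier 2001, §1.2 rule (2), §4.1] -/
theorem soloInformed_of_prod_sub_of_prod_comm_mem_mapGen {r : IntegralRep n} {t : IntegralRep l}
    (hr : SoloInformedIsVolRep r) (ht : SoloInformedIsVolRep t) :
    of (t.prod r) - of (r.prod t) ∈ soloInformedMapGen := by
  rw [IntegralRep.prod_eq_reindex_prod r t]
  exact ⟨l + n, n + l, _, _, Nat.add_comm l n, soloInformed_isVolRep_prod ht hr,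
    soloInformed_isVolRep_reindex (soloInformed_isVolRep_prod ht hr) _,
    soloInformed_of_sub_of_reindex_mem_changeOfVariablesRel _ _, rfl⟩

/-- The commutator `[τ] * c − c * [τ]` of a volume representation with an element of `𝒮` lies in
`𝒮` (on generators it is a signed sum of block flips). [this work] -/
theorem soloInformed_of_mul_sub_mul_of_mem_scissorsRel {t : IntegralRep l}
    (ht : SoloInformedIsVolRep t) {c : FormalRep} (hc : c ∈ soloInformedScissorsRel) :
    of t * c - c * of t ∈ soloInformedScissorsRel := by
  have flip : ∀ {d : ℕ} (s : IntegralRep d), SoloInformedIsVolRep s →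
      of t * of s - of s * of t ∈ soloInformedScissorsRel := fun s hs => by
    rw [of_mul_of, of_mul_of]
    exact soloInformed_mapGen_subset_scissorsRel
      (soloInformed_of_prod_sub_of_prod_comm_mem_mapGen hs ht)
  refine AddSubgroup.closure_induction (fun x hx => ?_) ?_ (fun x y _ _ hx hy => ?_)
    (fun x _ hx => ?_) hc
  · rcases hx with ⟨n, r, r₁, r₂, hr, h₁, h₂, -, rfl⟩ | ⟨n, m, r, r', -, hr, hr', -, rfl⟩
    · have : of t * (of r - of r₁ - of r₂) - (of r - of r₁ - of r₂) * of t =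
          (of t * of r - of r * of t) - (of t * of r₁ - of r₁ * of t) -
            (of t * of r₂ - of r₂ * of t) := by
        simp only [mul_sub, sub_mul]; abel
      rw [this]
      exact soloInformedScissorsRel.sub_mem (soloInformedScissorsRel.sub_mem (flip r hr) (flip r₁ h₁))
        (flip r₂ h₂)
    · have : of t * (of r - of r') - (of r - of r') * of t =
          (of t * of r - of r * of t) - (of t * of r' - of r' * of t) := by
        simp only [mul_sub, sub_mul]; abel
      rw [this]
      exact soloInformedScissorsRel.sub_mem (flip r hr) (flip r' hr')
  · simp only [mul_zero, zero_mul, sub_zero]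
    exact soloInformedScissorsRel.zero_mem
  · have : of t * (x + y) - (x + y) * of t = (of t * x - x * of t) + (of t * y - y * of t) := by
      rw [mul_add, add_mul]; abel
    rw [this]
    exact soloInformedScissorsRel.add_mem hx hy
  · have : of t * -x - -x * of t = -(of t * x - x * of t) := by
      rw [mul_neg, neg_mul]; abel
    rw [this]
    exact soloInformedScissorsRel.neg_mem hx

/-- **Right products**: `c ∈ 𝒮 → c * [τ] ∈ 𝒮` for a volume representation `τ`
(`c * [τ] = [τ] * c − ([τ] * c − c * [τ])`). [this work] -/
theorem soloInformed_mul_of_mem_scissorsRel {t : IntegralRep l} (ht : SoloInformedIsVolRep t)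
    {c : FormalRep} (hc : c ∈ soloInformedScissorsRel) : c * of t ∈ soloInformedScissorsRel := by
  have h := soloInformedScissorsRel.sub_mem (soloInformed_of_mul_mem_scissorsRel ht hc)
    (soloInformed_of_mul_sub_mul_of_mem_scissorsRel ht hc)
  rwa [sub_sub_cancel] at h

/-- **`𝒮` is stable under flattening**: `c ∈ 𝒮 → Fl c = c * [[0,1]] ∈ 𝒮`. [this work] -/
theorem soloInformed_flatMap_mem_scissorsRel {c : FormalRep} (hc : c ∈ soloInformedScissorsRel) :
    soloInformedFlatMap c ∈ soloInformedScissorsRel := by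
  rw [soloInformed_flatMap_apply]
  exact soloInformed_mul_of_mem_scissorsRel soloInformed_isVolRep_unitIntervalRep hc

/-- `c ∈ 𝒮 → Fl^k c ∈ 𝒮`. [this work] -/
theorem soloInformed_flatPow_mem_scissorsRel (k : ℕ) {c : FormalRep}
    (hc : c ∈ soloInformedScissorsRel) : soloInformedFlatPow k c ∈ soloInformedScissorsRel := by
  induction k with
  | zero => exact hc
  | succ k ih =>
    rw [soloInformed_flatPow_succ_apply]
    exact soloInformed_flatMap_mem_scissorsRel ih

/-- **`𝒮` is homogeneous**: the degree projections `π_d` preserve `𝒮` (every generator lives in one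
dimension), so scissors congruence of two volume representations of dimension `d` only involves
volume representations of dimension `d`. [this work] -/
theorem soloInformed_dimProj_mem_scissorsRel (d : ℕ) {c : FormalRep}
    (hc : c ∈ soloInformedScissorsRel) : soloInformedDimProj d c ∈ soloInformedScissorsRel := by
  refine AddSubgroup.closure_induction (fun x hx => ?_) ?_ (fun x y _ _ hx hy => ?_)
    (fun x _ hx => ?_) hc
  · rcases hx with ⟨n, r, r₁, r₂, hr, h₁, h₂, h, rfl⟩ | ⟨n, m, r, r', hnm, hr, hr', h, rfl⟩
    · by_cases hnd : n = d
      · subst hnd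
        rw [map_sub, map_sub, soloInformed_dimProj_of_self, soloInformed_dimProj_of_self,
          soloInformed_dimProj_of_self]
        exact soloInformed_scissorsGen_subset_scissorsRel ⟨n, r, r₁, r₂, hr, h₁, h₂, h, rfl⟩
      · rw [map_sub, map_sub, soloInformed_dimProj_of_ne hnd, soloInformed_dimProj_of_ne hnd,
          soloInformed_dimProj_of_ne hnd, sub_zero, sub_zero]
        exact soloInformedScissorsRel.zero_mem
    · subst hnm
      by_cases hnd : n = d
      · subst hnd
        rw [map_sub, soloInformed_dimProj_of_self, soloInformed_dimProj_of_self]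
        exact soloInformed_mapGen_subset_scissorsRel ⟨n, n, r, r', rfl, hr, hr', h, rfl⟩
      · rw [map_sub, soloInformed_dimProj_of_ne hnd, soloInformed_dimProj_of_ne hnd, sub_zero]
        exact soloInformedScissorsRel.zero_mem
  · rw [map_zero]; exact soloInformedScissorsRel.zero_mem
  · rw [map_add]; exact soloInformedScissorsRel.add_mem hx hy
  · rw [map_neg]; exact soloInformedScissorsRel.neg_mem hx

/-! ### Stable congruence persists under flattening -/

/-- Stable congruence persists under further flattening: congruent after `k` flattenings implies
congruent after `k + 1`. [this work] -/
theorem soloInformed_flatIter_succ_sub_mem_scissorsRel {r r' : IntegralRep n} {k : ℕ}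
    (h : of (soloInformedFlatIter r k) - of (soloInformedFlatIter r' k) ∈ soloInformedScissorsRel) :
    of (soloInformedFlatIter r (k + 1)) - of (soloInformedFlatIter r' (k + 1)) ∈
      soloInformedScissorsRel := by
  have h' := soloInformed_flatMap_mem_scissorsRel h
  rwa [map_sub, soloInformed_flatMap_of, soloInformed_flatMap_of] at h'

/-- Stable congruence persists under further flattening (all later stages). [this work] -/
theorem soloInformed_flatIter_sub_mem_scissorsRel_of_le {r r' : IntegralRep n} {k j : ℕ}
    (hkj : k ≤ j)
    (h : of (soloInformedFlatIter r k) - of (soloInformedFlatIter r' k) ∈ soloInformedScissorsRel) :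
    of (soloInformedFlatIter r j) - of (soloInformedFlatIter r' j) ∈ soloInformedScissorsRel := by
  induction hkj with
  | refl => exact h
  | step _ ih => exact soloInformed_flatIter_succ_sub_mem_scissorsRel ih

end Summit.KontsevichZagierPeriods.KontsevichZagierPeriods.Theorems

end
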